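import Literature.NumberTheory.EllipticCurves.Shintani32Kernel
import HarnessLib

/-!
# Cone Gauss sums on the level-`32` lattice: the genus character of `-8D` is a Weil eigenvector

[[cite: Shintani1975, §1 Prop. 1.6, Thm. 2]] — the finite (arithmetic) input of the level-`128`
transformation law of the twisted theta kernels `K₃₂,D` on `L♮₃₂ = {[32a, b, c]}`
(`Shintani32Kernel.kerD32`, weight `ω_D = genusWt32 D` of `Shintani32GenusSymbols`, the genus
character of `-8D`; route to `Literature.NumberTheory.EllipticCurves.Tunnell1983_a_sq_propto_L_one`
through Waldspurger's corollary at level `128`).  This is the `N = 32` twin of the tree's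
`ShintaniConeGaussSums` (`N = 64`): after Poisson summation over the classes of `ℤ³` modulo
`N = cD` the law for `γ = (a b; 128 d)` comes down to the cone Gauss sum

  `(★G₃₂)  ∑_{r ∈ (ℤ/N)³} ω_D(r - u) e_N(a · n₃₂(r)) = ω_D(-u) · N · G(32a; N)`,  `N = 128 D`,

`n₃₂(r) = 32r₁² - r₀r₂`, PROVED here as `coneSum32_wN32` by the CRT factorisation into

* the `2`-adic sum for ANY weight depending on `r₂` alone (`coneSum32_twoFactor`: the `r₀`-sum
  forces `r₂ = 0`), applied to the `2`-adic genus character `χ₈ · χ₋₄^{[D≡1(4)]}` (`twoWt`), and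
* the `D`-part (`dPartProp32_all`, induction over the square-free `D`), whose prime case is the
  heart of the file: **the cone symbol `Ω_p` of `L₃₂` is an eigenvector of the finite Fourier
  (Weil) operator of `n₃₂`** (`sum_coneSymF32_sub_mul_ψ`):
  `∑_{ρ ∈ 𝔽_p³} Ω_p(ρ - μ) e_p(t n₃₂(ρ)) = Ω_p(-μ) · p · G(32t; p)`.
  The cone `{n₃₂ = 0}` is parametrised by `λ(X + βY)²`, i.e. `(λ/32, λβ/32, λβ²)`, and `λY²`; the
  symbol of the first family is `χ(2 · λ/32) = χ(λ)` — this is why the local symbol of `L₃₂` carries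
  the factor `(2/p)` (`coneSym32`: `(2v₀/p)`) — and the extra `χ(32⁻¹) = χ(2)` produced by the
  pairing is matched by `G(32t; p) = χ(32t) g = χ(2)χ(t) g`.

Also proved (fed into the Poisson step): the bridge `genusWt32_eq_wN32`, the scaling
`coneSymZ32`/`wD32` bookkeeping, the vanishing of the Gauss coefficient sum OFF the sublattice
`L₃₂` (`64 ∤ k₁`: `sum_wN32_mul_stdAddChar_eq_zero`, shift `r₁ ↦ r₁ + 2D`) and the completed square
ON it (`sum_wN32_mul_stdAddChar_bZ32`).

No named facts.  Definitions: `nF32`, `bF32`, `binValF32`, `coneSymF32`, `nZ32`, `coneSum32`,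
`coneSymZ32`, `wD32`, `DPartProp32`, `twoWtR`, `wN32`, `bZ32`.
-/

noncomputable section

open Complex Finset

namespace Literature.NumberTheory.EllipticCurves.Shintani

open Literature.NumberTheory.EllipticCurves.ModularForms (quadGaussSum quadGaussSum_def
  sum_sq_eq_sum_card_mul quadGaussSum_prime_eq_quadraticChar_mul quadGaussSum_mul_of_coprime
  quadGaussSum_unit_sq_mul quadGaussSum_eq_one_of_eq_one)

section FiniteField

variable {p : ℕ} [hp : Fact p.Prime]

/-- `χ(16) = 1` (auxiliary). [folklore] -/
theorem χc_sixteen (hp2 : p ≠ 2) : χc p 16 = 1 := by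
  have : (16 : ZMod p) = 4 ^ 2 := by norm_num
  rw [this]
  refine χc_sq_eq_one ?_
  have : (4 : ZMod p) = 2 ^ 2 := by norm_num
  rw [this]; exact pow_ne_zero _ (two_ne_zero_zmod hp2)

/-! ### The cone of `n₃₂ = 32ρ₁² - ρ₀ρ₂` over `𝔽_p` -/

/-- Reduced discriminant `n₃₂(ρ) = 32ρ₁² - ρ₀ρ₂` over `𝔽_p`. [folklore] -/
def nF32 (ρ : Fin 3 → ZMod p) : ZMod p := 32 * ρ 1 ^ 2 - ρ 0 * ρ 2

/-- Its polar form `B(ρ, μ) = 64ρ₁μ₁ - ρ₀μ₂ - ρ₂μ₀`. [folklore] -/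
def bF32 (ρ μ : Fin 3 → ZMod p) : ZMod p := 64 * ρ 1 * μ 1 - ρ 0 * μ 2 - ρ 2 * μ 0

/-- Values of the binary form `[32μ₀, 64μ₁, μ₂]` over `𝔽_p`. [folklore] -/
def binValF32 (μ : Fin 3 → ZMod p) (s t : ZMod p) : ZMod p :=
  32 * μ 0 * s ^ 2 + 64 * μ 1 * s * t + μ 2 * t ^ 2

/-- `nF32_add` (auxiliary). [folklore] -/
theorem nF32_add (ρ μ : Fin 3 → ZMod p) : nF32 (ρ + μ) = nF32 ρ + bF32 ρ μ + nF32 μ := by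
  simp only [nF32, bF32, Pi.add_apply]; ring

/-- **The cone symbol of `L₃₂` over `𝔽_p`**: `0` off the cone `n₃₂ = 0`; on it `χ(2ρ₀)` (the value
`32ρ₀` at `(1,0)`, `32 = 2·4²`), or `χ(ρ₂)` if `ρ₀ = 0`. [folklore] -/
def coneSymF32 (ρ : Fin 3 → ZMod p) : ℂ :=
  if nF32 ρ = 0 then (if ρ 0 = 0 then χc p (ρ 2) else χc p (2 * ρ 0)) else 0

/-- `coneSymF32_of_ne` (auxiliary). [folklore] -/
theorem coneSymF32_of_ne {ρ : Fin 3 → ZMod p} (h : nF32 ρ ≠ 0) : coneSymF32 ρ = 0 := by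
  simp [coneSymF32, h]

/-- `coneSymF32_neg` (auxiliary). [folklore] -/
theorem coneSymF32_neg (ρ : Fin 3 → ZMod p) : coneSymF32 (-ρ) = χc p (-1) * coneSymF32 ρ := by
  unfold coneSymF32
  have : nF32 (-ρ) = nF32 ρ := by simp only [nF32, Pi.neg_apply]; ring
  rw [this]
  simp only [Pi.neg_apply, neg_eq_zero]
  split_ifs
  · rw [neg_eq_neg_one_mul, map_mul]
  · rw [show (2 : ZMod p) * -ρ 0 = -1 * (2 * ρ 0) by ring, map_mul]
  · rw [mul_zero]

/-- **(F3)₃₂** The sum of `χ` over the values of `k = [32μ₀, 64μ₁, μ₂]` at the `p + 1` points of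
`P¹(𝔽_p)`: `∑_β χ(k(β,-1)) + χ(k(1,0)) = p · Ω_p(μ)`. [folklore] -/
theorem sum_χc_binValF32 (hp2 : p ≠ 2) (μ : Fin 3 → ZMod p) :
    ∑ β : ZMod p, χc p (binValF32 μ β (-1)) + χc p (binValF32 μ 1 0) = (p : ℂ) * coneSymF32 μ := by
  have h2 := two_ne_zero_zmod (p := p) hp2
  have h32 := c32_ne_zero_zmod (p := p) hp2
  have h16 := χc_sixteen (p := p) hp2
  have e10 : binValF32 μ 1 0 = 16 * (2 * μ 0) := by simp only [binValF32]; ring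
  have eβ : ∀ β : ZMod p, binValF32 μ β (-1) = 32 * μ 0 * β ^ 2 + (-64 * μ 1) * β + μ 2 := by
    intro β; simp only [binValF32]; ring
  simp_rw [eβ, e10]
  unfold coneSymF32
  by_cases h0 : μ 0 = 0
  · simp_rw [h0, mul_zero, zero_mul, zero_add, MulChar.map_zero, add_zero, if_true]
    by_cases h1 : μ 1 = 0
    · have hn : nF32 μ = 0 := by simp only [nF32, h0, h1]; ring
      simp_rw [h1, mul_zero, zero_mul, zero_add, if_pos hn, Finset.sum_const, Finset.card_univ,
        ZMod.card, nsmul_eq_mul]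
    · have hn : nF32 μ ≠ 0 := by
        simp only [nF32, h0, zero_mul, sub_zero]
        exact mul_ne_zero h32 (pow_ne_zero _ h1)
      rw [if_neg hn, mul_zero]
      have hc : (-64 : ZMod p) * μ 1 ≠ 0 := by
        refine mul_ne_zero ?_ h1
        have : (-64 : ZMod p) = -(2 * 32) := by norm_num
        rw [this, neg_ne_zero]
        exact mul_ne_zero h2 h32
      have : ∑ β : ZMod p, χc p (-64 * μ 1 * β + μ 2) = ∑ x : ZMod p, χc p x := by
        refine Fintype.sum_equiv ((Equiv.mulLeft₀ _ hc).trans (Equiv.addRight (μ 2))) _ _ fun β ↦ ?_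
        simp
      rw [this]
      exact MulChar.sum_eq_zero_of_ne_one (χc_ne_one hp2)
  · have hA : (32 : ZMod p) * μ 0 ≠ 0 := mul_ne_zero h32 h0
    rw [sum_χc_quadratic hp2 hA, if_neg h0]
    have hdisc : (-64 * μ 1) ^ 2 - 4 * (32 * μ 0) * μ 2 = 128 * nF32 μ := by
      simp only [nF32]; ring
    have h128 : (128 : ZMod p) ≠ 0 := by
      have : (128 : ZMod p) = 2 ^ 7 := by norm_num
      rw [this]; exact pow_ne_zero _ h2
    have hχ32 : χc p (32 * μ 0) = χc p (2 * μ 0) := by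
      rw [show (32 : ZMod p) * μ 0 = 16 * (2 * μ 0) by ring, map_mul, h16, one_mul]
    rw [hdisc, hχ32, map_mul (χc p) 16, h16, one_mul]
    by_cases hn : nF32 μ = 0
    · rw [if_pos (by rw [hn, mul_zero]), if_pos hn]; ring
    · rw [if_neg (mul_ne_zero h128 hn), if_neg hn]; ring

/-- **(F4)₃₂** Summing against the cone symbol: the nonzero cone vectors are
`(λ/32, λβ/32, λβ²)` (the forms `λ(X + βY)²`, symbol `χ(2λ/32) = χ(λ)`) and `(0, 0, λ)` (`λY²`),
each once. [folklore] -/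
theorem sum_coneSymF32_mul (hp2 : p ≠ 2) (F : (Fin 3 → ZMod p) → ℂ) :
    ∑ κ : Fin 3 → ZMod p, coneSymF32 κ * F κ =
      ∑ l : ZMod p, ∑ β : ZMod p, χc p l * F (vec3 (l / 32) (l * β / 32) (l * β ^ 2)) +
        ∑ l : ZMod p, χc p l * F (vec3 0 0 l) := by
  classical
  have htwo := two_ne_zero_zmod (p := p) hp2
  have h32 := c32_ne_zero_zmod (p := p) hp2
  have h16 := χc_sixteen (p := p) hp2
  rw [sum_vec3]
  set T : ZMod p → ℂ := fun a ↦ ∑ b : ZMod p, ∑ c : ZMod p, coneSymF32 (vec3 a b c) * F (vec3 a b c)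
    with hT
  change ∑ a : ZMod p, T a = _
  have hT0 : T 0 = ∑ l : ZMod p, χc p l * F (vec3 0 0 l) := by
    rw [hT]
    dsimp only
    have inner : ∀ b : ZMod p, ∑ c : ZMod p, coneSymF32 (vec3 0 b c) * F (vec3 0 b c) =
        if b = 0 then ∑ c : ZMod p, χc p c * F (vec3 0 0 c) else 0 := by
      intro b
      split_ifs with hb
      · rw [hb]
        refine Finset.sum_congr rfl fun c _ ↦ ?_
        unfold coneSymF32
        have : nF32 (vec3 (0 : ZMod p) 0 c) = 0 := by simp [nF32]
        rw [if_pos this]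
        simp only [vec3_zero, vec3_two, if_true]
      · refine Finset.sum_eq_zero fun c _ ↦ ?_
        rw [coneSymF32_of_ne, zero_mul]
        simp only [nF32, vec3_zero, vec3_one, vec3_two, zero_mul, sub_zero]
        exact mul_ne_zero h32 (pow_ne_zero _ hb)
    simp_rw [inner]
    rw [Finset.sum_ite_eq' Finset.univ (0 : ZMod p), if_pos (Finset.mem_univ _)]
  have hTa : ∀ a : ZMod p, a ≠ 0 →
      T a = χc p (2 * a) * ∑ b : ZMod p, F (vec3 a b (32 * b ^ 2 / a)) := by
    intro a ha
    rw [hT]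
    dsimp only
    rw [Finset.mul_sum]
    refine Finset.sum_congr rfl fun b _ ↦ ?_
    have inner : ∀ c : ZMod p, coneSymF32 (vec3 a b c) * F (vec3 a b c) =
        if c = 32 * b ^ 2 / a then χc p (2 * a) * F (vec3 a b (32 * b ^ 2 / a)) else 0 := by
      intro c
      unfold coneSymF32
      simp only [vec3_zero, vec3_two, if_neg ha]
      have hiff : nF32 (vec3 a b c) = 0 ↔ c = 32 * b ^ 2 / a := by
        simp only [nF32, vec3_zero, vec3_one, vec3_two]
        rw [eq_div_iff ha, sub_eq_zero]
        constructor
        · intro h; linear_combination -h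
        · intro h; linear_combination -h
      by_cases hc : c = 32 * b ^ 2 / a
      · rw [if_pos (hiff.mpr hc), if_pos hc, hc]
      · rw [if_neg (mt hiff.mp hc), if_neg hc, zero_mul]
    simp_rw [inner]
    rw [Finset.sum_ite_eq' Finset.univ, if_pos (Finset.mem_univ _)]
  rw [Fintype.sum_eq_add_sum_compl (0 : ZMod p) T, hT0, add_comm]
  congr 1
  set T' : ZMod p → ℂ := fun a ↦ if a = 0 then 0 else T a with hT'
  have h1 : ∑ a ∈ ({0} : Finset (ZMod p))ᶜ, T a = ∑ a : ZMod p, T' a := by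
    rw [Fintype.sum_eq_add_sum_compl (0 : ZMod p) T']
    have : T' 0 = 0 := by simp [hT']
    rw [this, zero_add]
    refine Finset.sum_congr rfl fun a ha ↦ ?_
    rw [Finset.mem_compl, Finset.mem_singleton] at ha
    simp [hT', ha]
  have h2 : ∑ a : ZMod p, T' a = ∑ l : ZMod p, T' (l * 32⁻¹) :=
    (Equiv.sum_comp (Equiv.mulRight₀ (32⁻¹ : ZMod p) (inv_ne_zero h32)) T').symm
  rw [h1, h2]
  refine Finset.sum_congr rfl fun l _ ↦ ?_
  by_cases hl : l = 0
  · simp [hT', hl]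
  · have hl' : l * 32⁻¹ ≠ 0 := mul_ne_zero hl (inv_ne_zero h32)
    rw [hT']
    dsimp only
    rw [if_neg hl', hTa _ hl', Finset.mul_sum]
    -- `χ(2 λ/32) = χ(λ/16) = χ(λ)`
    have hχ : χc p (2 * (l * 32⁻¹)) = χc p l := by
      have e : (2 : ZMod p) * (l * 32⁻¹) = l * 16⁻¹ := by
        have h32fac : (32 : ZMod p) = 16 * 2 := by norm_num
        rw [h32fac, mul_inv]
        calc (2 : ZMod p) * (l * (16⁻¹ * 2⁻¹)) = l * 16⁻¹ * (2 * 2⁻¹) := by ring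
          _ = l * 16⁻¹ := by rw [mul_inv_cancel₀ htwo, mul_one]
      rw [e, map_mul]
      have h16i : χc p (16⁻¹ : ZMod p) = 1 := by
        have h16ne : (16 : ZMod p) ≠ 0 := by
          have : (16 : ZMod p) = 2 ^ 4 := by norm_num
          rw [this]; exact pow_ne_zero _ (two_ne_zero_zmod hp2)
        have h := (map_mul (χc p) (16⁻¹ : ZMod p) 16).symm
        rw [inv_mul_cancel₀ h16ne, map_one, h16, mul_one] at h
        exact h
      rw [h16i, mul_one]
    rw [hχ]
    symm
    refine Fintype.sum_equiv (Equiv.mulLeft₀ (l * 32⁻¹) hl') _ _ fun β ↦ ?_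
    simp only [Equiv.mulLeft₀_apply]
    congr 2
    funext i
    fin_cases i
    · show l / 32 = l * 32⁻¹
      rw [div_eq_mul_inv]
    · show l * β / 32 = l * 32⁻¹ * β
      rw [div_eq_mul_inv]; ring
    · show l * β ^ 2 = 32 * (l * 32⁻¹ * β) ^ 2 / (l * 32⁻¹)
      field_simp

/-! ### (F5)₃₂ The cone symbol is an eigenvector of the finite Fourier transform -/

/-- `bF32_family_one` (auxiliary). [folklore] -/
theorem bF32_family_one (l β : ZMod p) (μ : Fin 3 → ZMod p) (h32 : (32 : ZMod p) ≠ 0) :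
    bF32 (vec3 (l / 32) (l * β / 32) (l * β ^ 2)) μ = l * (-(binValF32 μ β (-1)) / 32) := by
  simp only [bF32, binValF32, vec3_zero, vec3_one, vec3_two]
  field_simp
  ring

/-- `bF32_family_two` (auxiliary). [folklore] -/
theorem bF32_family_two (l : ZMod p) (μ : Fin 3 → ZMod p) :
    bF32 (vec3 0 0 l) μ = l * (-(μ 0)) := by
  simp only [bF32, vec3_zero, vec3_one, vec3_two]; ring

/-- **The cone Gauss sum at an odd prime for `L₃₂`** (`t ≠ 0`, `μ ∈ 𝔽_p³`):
`∑_{ρ ∈ 𝔽_p³} Ω_p(ρ - μ) e_p(t · n₃₂(ρ)) = Ω_p(-μ) · p · G(32t; p)`. [folklore] -/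
theorem sum_coneSymF32_sub_mul_ψ (hp2 : p ≠ 2) {t : ZMod p} (ht : t ≠ 0) (μ : Fin 3 → ZMod p) :
    ∑ ρ : Fin 3 → ZMod p, coneSymF32 (ρ - μ) * ψp p (t * nF32 ρ) =
      coneSymF32 (-μ) * p * quadGaussSum p (32 * t) 0 := by
  classical
  have h2 := two_ne_zero_zmod (p := p) hp2
  have h32 := c32_ne_zero_zmod (p := p) hp2
  have h16 := χc_sixteen (p := p) hp2
  -- `χ(32⁻¹) = χ(2)` and `χ(32) = χ(2)`
  have hχ32 : χc p (32 : ZMod p) = χc p 2 := by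
    rw [show (32 : ZMod p) = 16 * 2 by norm_num, map_mul, h16, one_mul]
  have hχ32i : χc p (32⁻¹ : ZMod p) = χc p 2 := by
    have h := map_mul (χc p) (32⁻¹ : ZMod p) 32
    rw [inv_mul_cancel₀ h32, map_one, hχ32] at h
    -- `1 = χ(32⁻¹) χ(2)`, and `χ(2)² = 1`
    have hsq : χc p 2 * χc p 2 = 1 := χc_mul_self_eq_one h2
    linear_combination (-(χc p 2)) * h + (-(χc p (32⁻¹ : ZMod p))) * hsq
  -- shift `ρ = κ + μ`
  have step : ∑ ρ : Fin 3 → ZMod p, coneSymF32 (ρ - μ) * ψp p (t * nF32 ρ) =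
      ψp p (t * nF32 μ) * ∑ κ : Fin 3 → ZMod p, coneSymF32 κ * ψp p (t * bF32 κ μ) := by
    rw [Finset.mul_sum]
    symm
    refine Fintype.sum_equiv (Equiv.addRight μ) _ _ fun κ ↦ ?_
    rw [Equiv.coe_addRight, add_sub_cancel_right]
    by_cases hκ : nF32 κ = 0
    · rw [nF32_add, hκ, zero_add, mul_add, AddChar.map_add_eq_mul]; ring
    · rw [coneSymF32_of_ne hκ, zero_mul, mul_zero, zero_mul]
  rw [step, sum_coneSymF32_mul hp2]
  have fam1 : ∀ β : ZMod p,
      ∑ l : ZMod p, χc p l * ψp p (t * bF32 (vec3 (l / 32) (l * β / 32) (l * β ^ 2)) μ) =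
        χc p (-t) * χc p 2 * χc p (binValF32 μ β (-1)) * gq p := by
    intro β
    have : ∀ l : ZMod p, t * bF32 (vec3 (l / 32) (l * β / 32) (l * β ^ 2)) μ =
        l * (-t * binValF32 μ β (-1) * 32⁻¹) := by
      intro l; rw [bF32_family_one l β μ h32]; field_simp
    simp_rw [this]
    rw [sum_χc_mul_ψ hp2, map_mul, map_mul, hχ32i]
    ring
  have fam2 : ∑ l : ZMod p, χc p l * ψp p (t * bF32 (vec3 0 0 l) μ) =
      χc p (-t) * χc p 2 * χc p (binValF32 μ 1 0) * gq p := by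
    have : ∀ l : ZMod p, t * bF32 (vec3 0 0 l) μ = l * (-t * μ 0) := by
      intro l; rw [bF32_family_two]; ring
    simp_rw [this]
    rw [sum_χc_mul_ψ hp2, map_mul]
    have e : binValF32 μ 1 0 = 32 * μ 0 := by simp only [binValF32]; ring
    rw [e, map_mul, hχ32]
    have hsq : χc p 2 * χc p 2 = 1 := χc_mul_self_eq_one h2
    linear_combination (-(χc p (-t) * χc p (μ 0) * gq p)) * hsq
  rw [Finset.sum_comm]
  simp_rw [fam1]
  rw [fam2, ← Finset.sum_mul, ← Finset.mul_sum]
  have key := sum_χc_binValF32 hp2 μ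
  have hrhs : coneSymF32 (-μ) * (p : ℂ) * quadGaussSum p (32 * t) 0 =
      χc p (-t) * χc p 2 * gq p * (p * coneSymF32 μ) := by
    rw [coneSymF32_neg,
      show quadGaussSum p (32 * t) 0 = χc p (32 * t) * gq p from
        quadGaussSum_prime_eq_quadraticChar_mul hp2 (mul_ne_zero h32 ht),
      map_mul, hχ32, show (-t : ZMod p) = -1 * t by ring, map_mul]
    ring
  rw [hrhs]
  by_cases hμ : coneSymF32 μ = 0
  · rw [hμ]
    have : ∑ β : ZMod p, χc p (binValF32 μ β (-1)) + χc p (binValF32 μ 1 0) = 0 := by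
      rw [key, hμ, mul_zero]
    rw [show χc p (-t) * χc p 2 * (∑ β : ZMod p, χc p (binValF32 μ β (-1))) * gq p +
        χc p (-t) * χc p 2 * χc p (binValF32 μ 1 0) * gq p =
        χc p (-t) * χc p 2 * gq p * (∑ β : ZMod p, χc p (binValF32 μ β (-1)) + χc p (binValF32 μ 1 0)) by ring,
      this]
    ring
  · have hn : nF32 μ = 0 := by
      by_contra h; exact hμ (coneSymF32_of_ne h)
    rw [hn, mul_zero, AddChar.map_zero_eq_one, one_mul]
    rw [show χc p (-t) * χc p 2 * (∑ β : ZMod p, χc p (binValF32 μ β (-1))) * gq p +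
        χc p (-t) * χc p 2 * χc p (binValF32 μ 1 0) * gq p =
        χc p (-t) * χc p 2 * gq p * (∑ β : ZMod p, χc p (binValF32 μ β (-1)) + χc p (binValF32 μ 1 0)) by ring,
      key]

end FiniteField

/-! ### Cone sums modulo a general `M` for `n₃₂`: the `2`-adic factor and multiplicativity -/

section General

open Literature.NumberTheory.LFunctions (stdAddChar_eq_mul_of_coprime)

variable {M : ℕ} [NeZero M]

/-- `n₃₂(r) = 32r₁² - r₀r₂` on `(ℤ/M)³`. [folklore] -/
def nZ32 (r : Fin 3 → ZMod M) : ZMod M := 32 * r 1 ^ 2 - r 0 * r 2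

/-- The weighted quadratic sum `∑_{r ∈ (ℤ/M)³} W(r) e_M(t · n₃₂(r))`. [folklore] -/
def coneSum32 (M : ℕ) [NeZero M] (W : (Fin 3 → ZMod M) → ℂ) (t : ZMod M) : ℂ :=
  ∑ r : Fin 3 → ZMod M, W r * ZMod.stdAddChar (t * nZ32 r)

/-- **The `2`-adic (and, generally, untwisted-in-`p`) factor**: for ANY weight depending on `r₂`
alone, `χ(r₂ - u₂)`, and a unit `t`: `∑_{r ∈ (ℤ/M)³} χ(r₂ - u₂) e_M(t n₃₂(r)) = χ(-u₂) · M · G(32t; M)`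
(the `r₀`-sum forces `r₂ = 0`; the `r₁`-sum is the Gauss sum). [folklore] -/
theorem coneSum32_twoFactor (χ : ZMod M → ℂ) {t : ZMod M} (ht : IsUnit t) (u₂ : ZMod M) :
    coneSum32 M (fun r ↦ χ (r 2 - u₂)) t = χ (-u₂) * M * quadGaussSum M (32 * t) 0 := by
  classical
  rw [coneSum32, sum_vecM]
  have inner : ∀ b c : ZMod M, ∑ a : ZMod M, χ (vecM a b c 2 - u₂) * ZMod.stdAddChar (t * nZ32 (vecM a b c)) =
      χ (c - u₂) * ZMod.stdAddChar (t * (32 * b ^ 2)) * (if c = 0 then (M : ℂ) else 0) := by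
    intro b c
    simp only [vecM_two]
    have : ∀ a : ZMod M, t * nZ32 (vecM a b c) = t * (32 * b ^ 2) + a * (-(t * c)) := by
      intro a; simp only [nZ32, vecM_zero, vecM_one, vecM_two]; ring
    simp_rw [this, AddChar.map_add_eq_mul]
    rw [← Finset.mul_sum, ← Finset.mul_sum, AddChar.sum_mulShift _ (ZMod.isPrimitive_stdAddChar M),
      ZMod.card, mul_assoc]
    congr 2
    by_cases hc : c = 0
    · simp [hc]
    · have : -(t * c) ≠ 0 := by
        rw [neg_ne_zero]
        exact (ht.mul_right_eq_zero).not.mpr hc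
      simp [hc, this]
  rw [Finset.sum_comm]
  have hbc : ∀ b : ZMod M, ∑ a : ZMod M, ∑ c : ZMod M,
      χ (vecM a b c 2 - u₂) * ZMod.stdAddChar (t * nZ32 (vecM a b c)) =
      ZMod.stdAddChar (t * (32 * b ^ 2)) * (χ (-u₂) * M) := by
    intro b
    rw [Finset.sum_comm]
    simp_rw [inner b, mul_ite, mul_zero]
    rw [Finset.sum_ite_eq' Finset.univ (0 : ZMod M), if_pos (Finset.mem_univ _), zero_sub]
    ring
  simp_rw [hbc]
  rw [← Finset.sum_mul, quadGaussSum_def]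
  simp_rw [zero_mul, add_zero, show ∀ r : ZMod M, 32 * t * r ^ 2 = t * (32 * r ^ 2) from
    fun r ↦ by ring]
  ring

omit [NeZero M] in
/-- `n₃₂` commutes with ring homomorphisms. [folklore] -/
theorem map_nZ32 {M₁ : ℕ} (f : ZMod M →+* ZMod M₁) (r : Fin 3 → ZMod M) :
    f (nZ32 r) = nZ32 (fun i ↦ f (r i)) := by
  simp only [nZ32, map_sub, map_mul, map_pow, map_ofNat]

/-- **Multiplicativity of cone sums** (CRT), as `coneSum_mul_of_coprime` for `n₃₂`. [folklore] -/
theorem coneSum32_mul_of_coprime {M₁ M₂ : ℕ} [NeZero M₁] [NeZero M₂] [NeZero (M₁ * M₂)]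
    (h : M₁.Coprime M₂) (W₁ : (Fin 3 → ZMod M₁) → ℂ) (W₂ : (Fin 3 → ZMod M₂) → ℂ)
    (t : ZMod (M₁ * M₂)) :
    coneSum32 (M₁ * M₂) (fun r ↦ W₁ (fun i ↦ ZMod.castHom (dvd_mul_right M₁ M₂) (ZMod M₁) (r i)) *
        W₂ (fun i ↦ ZMod.castHom (dvd_mul_left M₂ M₁) (ZMod M₂) (r i))) t =
      coneSum32 M₁ W₁ ((M₂ : ZMod M₁)⁻¹ * ZMod.castHom (dvd_mul_right M₁ M₂) (ZMod M₁) t) *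
        coneSum32 M₂ W₂ ((M₁ : ZMod M₂)⁻¹ * ZMod.castHom (dvd_mul_left M₂ M₁) (ZMod M₂) t) := by
  classical
  rw [coneSum32, coneSum32, coneSum32, Finset.sum_mul_sum, ← Fintype.sum_prod_type']
  refine Fintype.sum_equiv (crt3 h) _ _ fun r ↦ ?_
  have e1 : (crt3 h r).1 = fun i ↦ ZMod.castHom (dvd_mul_right M₁ M₂) (ZMod M₁) (r i) :=
    funext fun i ↦ crt3_fst h r i
  have e2 : (crt3 h r).2 = fun i ↦ ZMod.castHom (dvd_mul_left M₂ M₁) (ZMod M₂) (r i) :=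
    funext fun i ↦ crt3_snd h r i
  have h1 : ZMod.castHom (dvd_mul_right M₁ M₂) (ZMod M₁) (t * nZ32 r) =
      ZMod.castHom (dvd_mul_right M₁ M₂) (ZMod M₁) t *
        nZ32 (fun i ↦ ZMod.castHom (dvd_mul_right M₁ M₂) (ZMod M₁) (r i)) := by
    rw [map_mul, map_nZ32]
  have h2 : ZMod.castHom (dvd_mul_left M₂ M₁) (ZMod M₂) (t * nZ32 r) =
      ZMod.castHom (dvd_mul_left M₂ M₁) (ZMod M₂) t *
        nZ32 (fun i ↦ ZMod.castHom (dvd_mul_left M₂ M₁) (ZMod M₂) (r i)) := by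
    rw [map_mul, map_nZ32]
  rw [e1, e2, stdAddChar_eq_mul_of_coprime h (t * nZ32 r), h1, h2]
  ring_nf

end General

/-! ### The weights on residues and the `D`-part of the cone Gauss sum -/

section DPart

open Literature.NumberTheory.LFunctions (stdAddChar_eq_mul_of_coprime)

/-- The cone symbol of `L₃₂` of a residue vector mod `p`. [folklore] -/
def coneSymZ32 (p : ℕ) (ρ : Fin 3 → ZMod p) : ℤ := coneSym32 p (liftZ ρ)

/-- **Bridge**: `Ω_p` of `𝔽_p³` (`coneSymF32`) is the integer cone symbol of the lift. [folklore] -/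
theorem coneSymZ32_eq_coneSymF32 {p : ℕ} [hp : Fact p.Prime] (ρ : Fin 3 → ZMod p) :
    (coneSymZ32 p ρ : ℂ) = coneSymF32 ρ := by
  unfold coneSymZ32 coneSym32 coneSymF32 liftZ
  have hcast : ∀ i, (((ρ i).val : ℕ) : ZMod p) = ρ i := fun i ↦ ZMod.natCast_zmod_val (ρ i)
  have hcast' : ∀ i, (((ρ i).val : ℤ) : ZMod p) = ρ i := fun i ↦ by
    rw [Int.cast_natCast, hcast]
  have e1 : ((p : ℤ) ∣ nQ32 (fun i ↦ ((ρ i).val : ℤ))) ↔ nF32 ρ = 0 := by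
    rw [← intCast_zmod_eq_zero_iff (p := p)]
    unfold nQ32 nF32
    push_cast
    rw [hcast 0, hcast 1, hcast 2]
  have e2 : ((p : ℤ) ∣ ((ρ 0).val : ℤ)) ↔ ρ 0 = 0 := by
    rw [← intCast_zmod_eq_zero_iff (p := p), hcast' 0]
  by_cases hn : nF32 ρ = 0
  · rw [if_pos (e1.mpr hn), if_pos hn]
    by_cases h0 : ρ 0 = 0
    · rw [if_pos (e2.mpr h0), if_pos h0, jacobiSym_eq_quadraticChar, χc_apply, hcast' 2]
    · rw [if_neg (mt e2.mp h0), if_neg h0, jacobiSym_eq_quadraticChar, χc_apply]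
      push_cast
      rw [hcast 0]
  · rw [if_neg (mt e1.mp hn), if_neg hn, Int.cast_zero]

/-- The cone symbol of an integer vector is that of its residue. [folklore] -/
theorem coneSym32_eq_coneSymZ32 (p : ℕ) [NeZero p] (v : Fin 3 → ℤ) :
    coneSym32 p v = coneSymZ32 p (fun i ↦ (v i : ZMod p)) := by
  unfold coneSymZ32 liftZ
  refine coneSym32_congr (M := p) (dvd_refl _) fun i ↦ ?_
  rw [Int.ModEq, ZMod.val_intCast, Int.emod_emod_of_dvd _ (dvd_refl _)]

/-- The cone symbol of a residue vector mod `M` (with `p ∣ M`) depends only on its image mod `p`. [folklore] -/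
theorem coneSym32_liftZ_eq {p M : ℕ} [NeZero M] [NeZero p] (r : Fin 3 → ZMod M) :
    coneSym32 p (liftZ r) = coneSymZ32 p (fun i ↦ ((r i).cast : ZMod p)) := by
  unfold coneSymZ32 liftZ
  refine coneSym32_congr (M := p) (dvd_refl _) fun i ↦ ?_
  show ((r i).val : ℤ) ≡ ((((r i).cast : ZMod p)).val : ℤ) [ZMOD p]
  rw [ZMod.cast_eq_val, ZMod.val_natCast, Int.ModEq]
  push_cast
  rw [Int.emod_emod_of_dvd _ (dvd_refl _)]

/-- **The odd part of the weight on residues**: `w_D(r) = ∏_{p ∣ D} Ω_p(r mod p)`. [folklore] -/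
def wD32 (D : ℕ) {M : ℕ} (r : Fin 3 → ZMod M) : ℂ :=
  ((∏ p ∈ D.primeFactors, coneSymZ32 p (fun i ↦ ((r i).cast : ZMod p)) : ℤ) : ℂ)

/-- `w_D` is compatible with reduction (`D ∣ M₁ ∣ M`). [folklore] -/
theorem wD32_castHom {D M M₁ : ℕ} [NeZero M] (hDM : D ∣ M₁) (h : M₁ ∣ M) (r : Fin 3 → ZMod M) :
    wD32 D r = wD32 D (fun i ↦ ZMod.castHom h (ZMod M₁) (r i)) := by
  haveI : NeZero M₁ := ⟨fun h0 ↦ by subst h0; exact NeZero.ne M (Nat.eq_zero_of_zero_dvd h)⟩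
  unfold wD32
  congr 1
  refine Finset.prod_congr rfl fun p hp ↦ ?_
  have hpD : p ∣ D := Nat.dvd_of_mem_primeFactors hp
  congr 1
  funext i
  show (ZMod.castHom (dvd_trans (dvd_trans hpD hDM) h) (ZMod p)) (r i) =
    (ZMod.castHom (dvd_trans hpD hDM) (ZMod p)) ((ZMod.castHom h (ZMod M₁)) (r i))
  rw [← RingHom.comp_apply (ZMod.castHom (dvd_trans hpD hDM) (ZMod p)), ZMod.castHom_comp]

/-- **Multiplicativity of `w`** for coprime `a, b`. [folklore] -/
theorem wD32_mul {a b M : ℕ} (hab : a.Coprime b) (ha : a ≠ 0) (hb : b ≠ 0) (r : Fin 3 → ZMod M) :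
    wD32 (a * b) r = wD32 a r * wD32 b r := by
  unfold wD32
  rw [Nat.primeFactors_mul ha hb, Finset.prod_union hab.disjoint_primeFactors, Int.cast_mul]

/-- `w_p = Ω_p` for a prime `p` (auxiliary). [folklore] -/
theorem wD32_prime {p : ℕ} [hp : Fact p.Prime] (r : Fin 3 → ZMod p) : wD32 p r = coneSymF32 r := by
  unfold wD32
  rw [Nat.Prime.primeFactors hp.out, Finset.prod_singleton, coneSymZ32_eq_coneSymF32]
  congr 1
  funext i
  exact ZMod.cast_id p (r i)

/-- `wD32_one` (auxiliary). [folklore] -/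
theorem wD32_one {M : ℕ} (r : Fin 3 → ZMod M) : wD32 1 r = 1 := by
  simp [wD32]

/-- The predicate proved by induction over square-free `D`. [folklore] -/
def DPartProp32 (D : ℕ) : Prop :=
  ∀ [NeZero D], Squarefree D → Odd D → ∀ (t : ZMod D), IsUnit t → ∀ u : Fin 3 → ZMod D,
    coneSum32 D (fun r ↦ wD32 D (r - u)) t = wD32 D (-u) * D * quadGaussSum D (32 * t) 0

/-- `dPartProp32_one` (auxiliary). [folklore] -/
theorem dPartProp32_one : DPartProp32 1 := by
  intro _ _ _ t _ u
  rw [wD32_one, one_mul, coneSum32, quadGaussSum_eq_one_of_eq_one rfl, Nat.cast_one, mul_one]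
  have : ∀ r : Fin 3 → ZMod 1, wD32 1 (r - u) * ZMod.stdAddChar (t * nZ32 r) = 1 := by
    intro r
    rw [wD32_one, one_mul]
    have : t * nZ32 r = 0 := Subsingleton.elim _ _
    rw [this, AddChar.map_zero_eq_one]
  simp_rw [this]
  rw [Finset.sum_const, Finset.card_univ, nsmul_eq_mul, mul_one]
  simp

/-- `dPartProp32_prime` (auxiliary). [folklore] -/
theorem dPartProp32_prime {p : ℕ} (hp : p.Prime) : DPartProp32 p := by
  intro _ _ hodd t ht u
  haveI := Fact.mk hp
  have hp2 : p ≠ 2 := by rintro rfl; exact (Nat.not_even_iff_odd.mpr hodd) even_two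
  have ht0 : t ≠ 0 := ht.ne_zero
  rw [show (fun r : Fin 3 → ZMod p ↦ wD32 p (r - u)) = fun r ↦ coneSymF32 (r - u) from
    funext fun r ↦ wD32_prime _, wD32_prime, coneSum32]
  exact sum_coneSymF32_sub_mul_ψ hp2 ht0 u

/-- `dPartProp32_mul` (auxiliary). [folklore] -/
theorem dPartProp32_mul {a b : ℕ} (h1a : 1 < a) (h1b : 1 < b) (hab : a.Coprime b)
    (ha : DPartProp32 a) (hb : DPartProp32 b) : DPartProp32 (a * b) := by
  intro _ hsq hodd t ht u
  haveI : NeZero a := ⟨by omega⟩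
  haveI : NeZero b := ⟨by omega⟩
  have hsqa : Squarefree a := hsq.of_mul_left
  have hsqb : Squarefree b := hsq.of_mul_right
  have hodda : Odd a := (Nat.odd_mul.mp hodd).1
  have hoddb : Odd b := (Nat.odd_mul.mp hodd).2
  set ua : Fin 3 → ZMod a := fun i ↦ ZMod.castHom (dvd_mul_right a b) (ZMod a) (u i) with hua'
  set ub : Fin 3 → ZMod b := fun i ↦ ZMod.castHom (dvd_mul_left b a) (ZMod b) (u i) with hub'
  set W₁ : (Fin 3 → ZMod a) → ℂ := fun ρ ↦ wD32 a (ρ - ua) with hW₁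
  set W₂ : (Fin 3 → ZMod b) → ℂ := fun ρ ↦ wD32 b (ρ - ub) with hW₂
  have hW : (fun r : Fin 3 → ZMod (a * b) ↦ wD32 (a * b) (r - u)) = fun r ↦
      W₁ (fun i ↦ ZMod.castHom (dvd_mul_right a b) (ZMod a) (r i)) *
      W₂ (fun i ↦ ZMod.castHom (dvd_mul_left b a) (ZMod b) (r i)) := by
    funext r
    rw [wD32_mul hab (by omega) (by omega),
      wD32_castHom (dvd_refl a) (dvd_mul_right a b), wD32_castHom (dvd_refl b) (dvd_mul_left b a)]
    simp only [hW₁, hW₂, hua', hub', Pi.sub_apply, map_sub]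
    rfl
  rw [hW, coneSum32_mul_of_coprime hab W₁ W₂ t]
  have hbu : IsUnit (b : ZMod a) := (ZMod.isUnit_iff_coprime b a).mpr hab.symm
  have hau : IsUnit (a : ZMod b) := (ZMod.isUnit_iff_coprime a b).mpr hab
  have hbinv : IsUnit ((b : ZMod a)⁻¹) := IsUnit.of_mul_eq_one (b : ZMod a) (ZMod.inv_mul_of_unit _ hbu)
  have hainv : IsUnit ((a : ZMod b)⁻¹) := IsUnit.of_mul_eq_one (a : ZMod b) (ZMod.inv_mul_of_unit _ hau)
  have hta : IsUnit ((b : ZMod a)⁻¹ * ZMod.castHom (dvd_mul_right a b) (ZMod a) t) :=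
    hbinv.mul (ht.map _)
  have htb : IsUnit ((a : ZMod b)⁻¹ * ZMod.castHom (dvd_mul_left b a) (ZMod b) t) :=
    hainv.mul (ht.map _)
  rw [show coneSum32 a W₁ _ = _ from ha hsqa hodda _ hta ua,
    show coneSum32 b W₂ _ = _ from hb hsqb hoddb _ htb ub]
  have hw : wD32 (a * b) (-u) = wD32 a (-ua) * wD32 b (-ub) := by
    rw [wD32_mul hab (by omega) (by omega),
      wD32_castHom (dvd_refl a) (dvd_mul_right a b), wD32_castHom (dvd_refl b) (dvd_mul_left b a)]
    simp only [hua', hub', Pi.neg_apply, map_neg]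
    rfl
  have htval : t = ((t.val : ℕ) : ZMod (a * b)) := (ZMod.natCast_zmod_val t).symm
  have hG := quadGaussSum_mul_of_coprime hab (32 * t.val : ℤ)
  have e0 : ((32 * t.val : ℤ) : ZMod (a * b)) = 32 * t := by
    push_cast; rw [ZMod.natCast_zmod_val]
  have ea : ((b * (32 * t.val) : ℤ) : ZMod a) =
      (b : ZMod a) ^ 2 * ((b : ZMod a)⁻¹ * ZMod.castHom (dvd_mul_right a b) (ZMod a) t) * 32 := by
    rw [ZMod.castHom_apply, ZMod.cast_eq_val, htval]
    rw [ZMod.val_natCast, Nat.mod_eq_of_lt (ZMod.val_lt t)]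
    push_cast
    have : (b : ZMod a) * (b : ZMod a)⁻¹ = 1 := ZMod.mul_inv_of_unit _ hbu
    linear_combination (-(32 * (t.val : ZMod a) * (b : ZMod a))) * this
  have eb : ((a * (32 * t.val) : ℤ) : ZMod b) =
      (a : ZMod b) ^ 2 * ((a : ZMod b)⁻¹ * ZMod.castHom (dvd_mul_left b a) (ZMod b) t) * 32 := by
    rw [ZMod.castHom_apply, ZMod.cast_eq_val, htval]
    rw [ZMod.val_natCast, Nat.mod_eq_of_lt (ZMod.val_lt t)]
    push_cast
    have : (a : ZMod b) * (a : ZMod b)⁻¹ = 1 := ZMod.mul_inv_of_unit _ hau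
    linear_combination (-(32 * (t.val : ZMod b) * (a : ZMod b))) * this
  rw [e0, ea, eb, mul_assoc ((b : ZMod a) ^ 2), mul_assoc ((a : ZMod b) ^ 2),
    quadGaussSum_unit_sq_mul hbu, quadGaussSum_unit_sq_mul hau] at hG
  rw [hw, hG, mul_comm (32 : ZMod a), mul_comm (32 : ZMod b)]
  push_cast
  ring

/-- **The `D`-part of the cone Gauss sum for `L₃₂`** (`D` odd square-free, `t` a unit mod `D`):
`∑_{r ∈ (ℤ/D)³} w_D(r - u) e_D(t n₃₂(r)) = w_D(-u) · D · G(32t; D)`. [folklore] -/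
theorem dPartProp32_all (D : ℕ) : DPartProp32 D := by
  induction D using Nat.recOnPosPrimePosCoprime with
  | prime_pow p n hp hn =>
    rcases Nat.lt_or_ge 1 n with h2 | h2
    · intro _ hsq
      exfalso
      have hdvd : p * p ∣ p ^ n := by
        rw [← sq]; exact pow_dvd_pow p h2
      have := hsq p hdvd
      rw [Nat.isUnit_iff] at this
      exact hp.one_lt.ne' this
    · have hn1 : n = 1 := by omega
      subst hn1
      rw [pow_one]
      exact @dPartProp32_prime p hp
  | zero => intro _ hsq; exact absurd hsq not_squarefree_zero
  | one => exact dPartProp32_one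
  | coprime a b ha hb hab iha ihb => exact dPartProp32_mul ha hb hab iha ihb

/-! ### The full weight `ω_D` on residues modulo `N = 128 D` and the cone Gauss sum `(★G₃₂)` -/

/-- The `2`-adic genus character on residues: `twoWt D (r₂ mod 8)` for `r ∈ (ℤ/M)³`, `8 ∣ M`. [folklore] -/
def twoWtR (D : ℕ) {M : ℕ} (h8 : 8 ∣ M) (x : ZMod M) : ℂ :=
  ((twoWt D ((ZMod.castHom h8 (ZMod 8) x).val : ℤ) : ℤ) : ℂ)

/-- **The weight on residues**: `ω_D(r) = twoWt_D(r₂ mod 8) · w_D(r)` for `r ∈ (ℤ/M)³`, `8 ∣ M`. [folklore] -/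
def wN32 (D : ℕ) {M : ℕ} (h8 : 8 ∣ M) (r : Fin 3 → ZMod M) : ℂ :=
  twoWtR D h8 (r 2) * wD32 D r

/-- `128` is prime to every odd number. [folklore] -/
theorem coprime_128_of_odd {D : ℕ} (hD : Odd D) : Nat.Coprime 128 D := by
  have : Nat.Coprime 2 D := Nat.coprime_two_left.mpr hD
  simpa using Nat.Coprime.pow_left 7 this

/-- **The cone Gauss sum `(★G₃₂)`** (`D` odd square-free, `N = 128 D`, `a` a unit mod `N`,
`u ∈ (ℤ/N)³`): `∑_{r ∈ (ℤ/N)³} ω_D(r - u) e_N(a · n₃₂(r)) = ω_D(-u) · N · G(32a; N)`. [folklore] -/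
theorem coneSum32_wN32 {D : ℕ} [NeZero D] (hsq : Squarefree D) (hodd : Odd D) (h8 : 8 ∣ 128 * D)
    (a : ZMod (128 * D)) (ha : IsUnit a) (u : Fin 3 → ZMod (128 * D)) :
    coneSum32 (128 * D) (fun r ↦ wN32 D h8 (r - u)) a =
      wN32 D h8 (-u) * (128 * D : ℕ) * quadGaussSum (128 * D) (32 * a) 0 := by
  have hcop : Nat.Coprime 128 D := coprime_128_of_odd hodd
  haveI : NeZero (128 * D) := ⟨mul_ne_zero (by norm_num) (NeZero.ne D)⟩
  haveI : NeZero (128 : ℕ) := ⟨by norm_num⟩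
  set π₁ := ZMod.castHom (dvd_mul_right 128 D) (ZMod 128) with hπ₁
  set π₂ := ZMod.castHom (dvd_mul_left D 128) (ZMod D) with hπ₂
  have h8' : (8 : ℕ) ∣ 128 := by norm_num
  set u₁ : Fin 3 → ZMod 128 := fun i ↦ π₁ (u i) with hu₁
  set u₂ : Fin 3 → ZMod D := fun i ↦ π₂ (u i) with hu₂
  set χ₁ : ZMod 128 → ℂ := fun x ↦ twoWtR D h8' x with hχ₁
  set W₁ : (Fin 3 → ZMod 128) → ℂ := fun ρ ↦ χ₁ (ρ 2 - u₁ 2) with hW₁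
  set W₂ : (Fin 3 → ZMod D) → ℂ := fun ρ ↦ wD32 D (ρ - u₂) with hW₂
  -- the `2`-adic character factors through `ℤ/128`
  have hχ : ∀ x : ZMod (128 * D), twoWtR D h8 x = twoWtR D h8' (π₁ x) := by
    intro x
    unfold twoWtR
    rw [hπ₁, ← RingHom.comp_apply (ZMod.castHom h8' (ZMod 8)), ZMod.castHom_comp]
  have hW : (fun r : Fin 3 → ZMod (128 * D) ↦ wN32 D h8 (r - u)) = fun r ↦
      W₁ (fun i ↦ ZMod.castHom (dvd_mul_right 128 D) (ZMod 128) (r i)) *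
      W₂ (fun i ↦ ZMod.castHom (dvd_mul_left D 128) (ZMod D) (r i)) := by
    funext r
    rw [wN32, hχ, wD32_castHom (dvd_refl D) (dvd_mul_left D 128)]
    simp only [hW₁, hW₂, hχ₁, hu₁, hu₂, Pi.sub_apply, map_sub]
    rfl
  rw [hW, coneSum32_mul_of_coprime hcop W₁ W₂ a]
  have hDu : IsUnit ((D : ℕ) : ZMod 128) := (ZMod.isUnit_iff_coprime D 128).mpr hcop.symm
  have h128u : IsUnit ((128 : ℕ) : ZMod D) := (ZMod.isUnit_iff_coprime 128 D).mpr hcop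
  have hDinv : IsUnit ((D : ZMod 128)⁻¹) := IsUnit.of_mul_eq_one (D : ZMod 128)
    (ZMod.inv_mul_of_unit _ hDu)
  have h128inv : IsUnit (((128 : ℕ) : ZMod D)⁻¹) := IsUnit.of_mul_eq_one ((128 : ℕ) : ZMod D)
    (ZMod.inv_mul_of_unit _ h128u)
  have ht₁ : IsUnit ((D : ZMod 128)⁻¹ * π₁ a) := hDinv.mul (ha.map _)
  have ht₂ : IsUnit ((((128 : ℕ) : ZMod D))⁻¹ * π₂ a) := h128inv.mul (ha.map _)
  have hS₁ : coneSum32 128 W₁ ((D : ZMod 128)⁻¹ * π₁ a) =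
      χ₁ (-u₁ 2) * 128 * quadGaussSum 128 (32 * ((D : ZMod 128)⁻¹ * π₁ a)) 0 := by
    have := coneSum32_twoFactor (M := 128) χ₁ ht₁ (u₁ 2)
    rw [hW₁]
    exact_mod_cast this
  have hS₂ : coneSum32 D W₂ ((((128 : ℕ) : ZMod D))⁻¹ * π₂ a) =
      wD32 D (-u₂) * D * quadGaussSum D (32 * ((((128 : ℕ) : ZMod D))⁻¹ * π₂ a)) 0 :=
    dPartProp32_all D hsq hodd _ ht₂ u₂
  rw [show ((128 : ℕ) : ZMod D) = (128 : ZMod D) by push_cast; rfl] at hS₂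
  rw [hS₁]
  erw [hS₂]
  have hw : wN32 D h8 (-u) = χ₁ (-u₁ 2) * wD32 D (-u₂) := by
    rw [wN32, hχ, wD32_castHom (dvd_refl D) (dvd_mul_left D 128)]
    simp only [hχ₁, hu₁, hu₂, Pi.neg_apply, map_neg]
    rfl
  have hG := quadGaussSum_mul_of_coprime hcop (32 * a.val : ℤ)
  push_cast at hG
  have e0 : (32 : ZMod (128 * D)) * ((a.val : ℕ) : ZMod (128 * D)) = 32 * a := by
    rw [ZMod.natCast_zmod_val]
  have hπ₁a : π₁ a = ((a.val : ℕ) : ZMod 128) := by rw [hπ₁, ZMod.castHom_apply, ZMod.cast_eq_val]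
  have hπ₂a : π₂ a = ((a.val : ℕ) : ZMod D) := by rw [hπ₂, ZMod.castHom_apply, ZMod.cast_eq_val]
  have ea : (D : ZMod 128) * (32 * ((a.val : ℕ) : ZMod 128)) =
      (D : ZMod 128) ^ 2 * ((D : ZMod 128)⁻¹ * π₁ a) * 32 := by
    rw [hπ₁a]
    have : (D : ZMod 128) * (D : ZMod 128)⁻¹ = 1 := ZMod.mul_inv_of_unit _ hDu
    linear_combination (-(32 * ((a.val : ℕ) : ZMod 128) * (D : ZMod 128))) * this
  have h128u' : IsUnit (128 : ZMod D) := by have := h128u; push_cast at this; exact this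
  have eb : (128 : ZMod D) * (32 * ((a.val : ℕ) : ZMod D)) =
      (128 : ZMod D) ^ 2 * ((128 : ZMod D)⁻¹ * π₂ a) * 32 := by
    rw [hπ₂a]
    have : (128 : ZMod D) * (128 : ZMod D)⁻¹ = 1 := ZMod.mul_inv_of_unit _ h128u'
    linear_combination (-(32 * ((a.val : ℕ) : ZMod D) * (128 : ZMod D))) * this
  rw [e0, ea, eb, mul_assoc ((D : ZMod 128) ^ 2), mul_assoc ((128 : ZMod D) ^ 2),
    quadGaussSum_unit_sq_mul hDu, quadGaussSum_unit_sq_mul h128u'] at hG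
  rw [hw, hG, mul_comm (32 : ZMod 128), mul_comm (32 : ZMod D)]
  push_cast
  ring

/-- **Bridge to the integer weight**: for `8 ∣ M`, `D ∣ M`, `genusWt32 D v = ω_D(v mod M)`. [folklore] -/
theorem genusWt32_eq_wN32 {D M : ℕ} [NeZero M] (h8 : 8 ∣ M) (hDM : D ∣ M) (v : Fin 3 → ℤ) :
    (genusWt32 D v : ℂ) = wN32 D h8 (fun i ↦ (v i : ZMod M)) := by
  unfold genusWt32 wN32 wD32 twoWtR
  rw [Int.cast_mul]
  congr 1
  · have : ZMod.castHom h8 (ZMod 8) ((v 2 : ℤ) : ZMod M) = ((v 2 : ℤ) : ZMod 8) := map_intCast _ _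
    rw [this]
    congr 1
    refine twoWt_congr D (dvd_refl 8) ?_
    rw [Int.ModEq, ZMod.val_intCast]
    push_cast
    rw [Int.emod_emod_of_dvd _ (dvd_refl _)]
  · congr 1
    refine Finset.prod_congr rfl fun p hp ↦ ?_
    haveI : NeZero p := ⟨(Nat.prime_of_mem_primeFactors hp).ne_zero⟩
    have hpM : p ∣ M := dvd_trans (Nat.dvd_of_mem_primeFactors hp) hDM
    rw [coneSym32_eq_coneSymZ32 p v]
    congr 2
    funext i
    rw [ZMod.cast_intCast hpM]

/-! ### Evaluation of the Gauss coefficients at `c = 128` -/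

/-- The polar form of `n₃₂` on `(ℤ/M)³`. [folklore] -/
def bZ32 {M : ℕ} (r u : Fin 3 → ZMod M) : ZMod M := 64 * r 1 * u 1 - r 0 * u 2 - r 2 * u 0

/-- `nZ32_add` (auxiliary). [folklore] -/
theorem nZ32_add {M : ℕ} (r u : Fin 3 → ZMod M) : nZ32 (r + u) = nZ32 r + bZ32 r u + nZ32 u := by
  simp only [nZ32, bZ32, Pi.add_apply]; ring

/-- `ω_D` does not see the coordinate `r₁` beyond `n₃₂`: shifting `r₁` by `2D` (`N = 128D`)
changes neither `ω_D` nor `n₃₂ (mod N)`. [folklore] -/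
theorem wN32_add_shift {D : ℕ} [NeZero D] (h8 : 8 ∣ 128 * D) (r : Fin 3 → ZMod (128 * D)) :
    wN32 D h8 (r + fun i ↦ if i = 1 then (2 * D : ZMod (128 * D)) else 0) = wN32 D h8 r := by
  unfold wN32 wD32
  congr 1
  · simp
  · congr 1
    refine Finset.prod_congr rfl fun p hp ↦ ?_
    have hpD : p ∣ D := Nat.dvd_of_mem_primeFactors hp
    congr 1
    funext i
    simp only [Pi.add_apply]
    split_ifs with hi
    · subst hi
      rw [ZMod.cast_add (dvd_mul_of_dvd_right hpD 128), show ((2 * D : ZMod (128 * D))).cast =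
        (ZMod.castHom (dvd_mul_of_dvd_right hpD 128) (ZMod p)) (2 * D) from rfl, map_mul, map_natCast,
        (ZMod.natCast_eq_zero_iff D p).mpr hpD, mul_zero, add_zero]
    · rw [add_zero]

/-- `nZ32_add_shift` (auxiliary). [folklore] -/
theorem nZ32_add_shift {D : ℕ} [NeZero D] (r : Fin 3 → ZMod (128 * D)) :
    nZ32 (r + fun i ↦ if i = 1 then (2 * D : ZMod (128 * D)) else 0) = nZ32 r := by
  simp only [nZ32, Pi.add_apply, if_true, show (0 : Fin 3) ≠ 1 by decide, show (2 : Fin 3) ≠ 1 by decide,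
    if_false, add_zero]
  have hN : ((128 * D : ℕ) : ZMod (128 * D)) = 0 := ZMod.natCast_self _
  push_cast at hN
  linear_combination (r 1 + D) * hN

/-- `ellZ_add_shift32` (auxiliary). [folklore] -/
theorem ellZ_add_shift32 {D : ℕ} [NeZero D] (r : Fin 3 → ZMod (128 * D)) (k : Fin 3 → ℤ) :
    ellZ (r + fun i ↦ if i = 1 then (2 * D : ZMod (128 * D)) else 0) k =
      ellZ r k + (2 * D : ZMod (128 * D)) * (k 1 : ZMod (128 * D)) := by
  simp only [ellZ, Pi.add_apply, if_true, show (0 : Fin 3) ≠ 1 by decide, show (2 : Fin 3) ≠ 1 by decide,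
    if_false, add_zero]
  ring

/-- `ψ_{128D}(2D k₁) = 1` only if `64 ∣ k₁`. [folklore] -/
theorem stdAddChar_shift32_ne_one {D : ℕ} [NeZero D] {k1 : ℤ} (hk : ¬ (64 : ℤ) ∣ k1) :
    (ZMod.stdAddChar ((2 * D * k1 : ℤ) : ZMod (128 * D)) : ℂ) ≠ 1 := by
  intro h
  have h0 : ((2 * D * k1 : ℤ) : ZMod (128 * D)) = 0 := by
    have h' : (ZMod.stdAddChar ((2 * D * k1 : ℤ) : ZMod (128 * D)) : ℂ) =
        ZMod.stdAddChar (0 : ZMod (128 * D)) := by rw [h, AddChar.map_zero_eq_one]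
    rw [ZMod.stdAddChar_apply, ZMod.stdAddChar_apply] at h'
    exact ZMod.injective_toCircle (Subtype.ext h')
  rw [ZMod.intCast_zmod_eq_zero_iff_dvd] at h0
  apply hk
  obtain ⟨m, hm⟩ := h0
  have hD : (D : ℤ) ≠ 0 := by exact_mod_cast NeZero.ne D
  refine ⟨m, ?_⟩
  have : (2 * D : ℤ) * k1 = (2 * D : ℤ) * (64 * m) := by push_cast at hm; linear_combination hm
  exact mul_left_cancel₀ (mul_ne_zero two_ne_zero hD) this

/-- **Off `L₃₂` the Gauss coefficient sum vanishes** (`N = 128D`, `64 ∤ k₁`):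
`∑_{r mod N} ω_D(r) ψ_N(a n₃₂(r) + ℓ(r, k)) = 0`. [folklore] -/
theorem sum_wN32_mul_stdAddChar_eq_zero {D : ℕ} [NeZero D] (h8 : 8 ∣ 128 * D) (a : ZMod (128 * D))
    (k : Fin 3 → ℤ) (hk : ¬ (64 : ℤ) ∣ k 1) :
    ∑ r : Fin 3 → ZMod (128 * D), wN32 D h8 r * ZMod.stdAddChar (a * nZ32 r + ellZ r k) = 0 := by
  set sh : Fin 3 → ZMod (128 * D) := fun i ↦ if i = 1 then (2 * D : ZMod (128 * D)) else 0 with hsh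
  set S := ∑ r : Fin 3 → ZMod (128 * D), wN32 D h8 r * ZMod.stdAddChar (a * nZ32 r + ellZ r k) with hS
  set F : (Fin 3 → ZMod (128 * D)) → ℂ := fun r ↦ wN32 D h8 r * ZMod.stdAddChar (a * nZ32 r + ellZ r k)
    with hF
  have hshift : S = ZMod.stdAddChar ((2 * D : ZMod (128 * D)) * (k 1 : ZMod (128 * D))) * S := by
    have h1 : S = ∑ r : Fin 3 → ZMod (128 * D), F (r + sh) :=
      (Fintype.sum_equiv (Equiv.addRight sh) (fun r ↦ F (r + sh)) F (fun _ ↦ rfl)).symm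
    conv_lhs => rw [h1]
    rw [hS, Finset.mul_sum]
    refine Finset.sum_congr rfl fun r _ ↦ ?_
    rw [hF]
    dsimp only
    rw [hsh, wN32_add_shift, nZ32_add_shift, ellZ_add_shift32, ← add_assoc, AddChar.map_add_eq_mul]
    ring
  have hne : (ZMod.stdAddChar ((2 * D : ZMod (128 * D)) * (k 1 : ZMod (128 * D))) : ℂ) ≠ 1 := by
    have := stdAddChar_shift32_ne_one (D := D) hk
    push_cast at this ⊢
    exact this
  have : (1 - ZMod.stdAddChar ((2 * D : ZMod (128 * D)) * (k 1 : ZMod (128 * D)))) * S = 0 := by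
    linear_combination hshift
  rcases mul_eq_zero.mp this with h | h
  · exact absurd (sub_eq_zero.mp h).symm hne
  · exact h

/-- `bZ32_smul_right` (auxiliary). [folklore] -/
theorem bZ32_smul_right {M : ℕ} (r u : Fin 3 → ZMod M) (t : ZMod M) : bZ32 r (t • u) = t * bZ32 r u := by
  simp only [bZ32, Pi.smul_apply, smul_eq_mul]; ring

/-- `nZ32_smul` (auxiliary). [folklore] -/
theorem nZ32_smul {M : ℕ} (t : ZMod M) (u : Fin 3 → ZMod M) : nZ32 (t • u) = t ^ 2 * nZ32 u := by
  simp only [nZ32, Pi.smul_apply, smul_eq_mul]; ring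

/-- **On `L₃₂` the Gauss coefficient sum is a cone Gauss sum** (`N = 128D`, `aa' = 1`):
`∑_r ω_D(r) ψ_N(a n₃₂(r) + B(r, u)) = ψ_N(-a' n₃₂(u)) · ω_D(-a'u) · N · G(32a; N)`. [folklore] -/
theorem sum_wN32_mul_stdAddChar_bZ32 {D : ℕ} [NeZero D] (hsq : Squarefree D) (hodd : Odd D)
    (h8 : 8 ∣ 128 * D) (a a' : ZMod (128 * D)) (haa' : a * a' = 1) (u : Fin 3 → ZMod (128 * D)) :
    ∑ r : Fin 3 → ZMod (128 * D), wN32 D h8 r * ZMod.stdAddChar (a * nZ32 r + bZ32 r u) =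
      ZMod.stdAddChar (-(a' * nZ32 u)) * (wN32 D h8 (-(a' • u)) * (128 * D : ℕ) *
        quadGaussSum (128 * D) (32 * a) 0) := by
  have ha : IsUnit a := IsUnit.of_mul_eq_one a' haa'
  have key : ∀ r : Fin 3 → ZMod (128 * D),
      a * nZ32 r + bZ32 r u = a * nZ32 (r + a' • u) + -(a' * nZ32 u) := by
    intro r
    rw [nZ32_add, bZ32_smul_right, nZ32_smul]
    linear_combination (-(bZ32 r u) - a' * nZ32 u) * haa'
  simp_rw [key, AddChar.map_add_eq_mul]
  rw [← coneSum32_wN32 hsq hodd h8 a ha (a' • u), coneSum32, Finset.mul_sum]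
  refine Fintype.sum_equiv (Equiv.addRight (a' • u)) _ _ fun r ↦ ?_
  simp only [Equiv.coe_addRight, add_sub_cancel_right]
  ring

end DPart

end Literature.NumberTheory.EllipticCurves.Shintani
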